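import Mathlib
import Summits.ValiantsHypothesis.ValiantsHypothesis.Theorems.NewtonUnitEquationsTwoProductsFormalLogLinearisationLiftedPencilCountBound
import HarnessLib

/-!
# Route NewtonUnitEquations — crux `TwoProducts` (stmt-ValiantsHypothesis-5906), line `relation_ladder` (rung R6 tool):
# hyperbolic cross and slot rank for functions of FINITE SHIFT RANK

Helper mode (`--supports stmt-ValiantsHypothesis-5906 --as helper`, no stub credit claimed; val-lit-p3 g14 for the
`relation_ladder` R6 tool `BinExpPencilCount` of val-idea-8 g3, `Cruxes/TwoProducts/Lines/relation_ladder_R6_tool.lean`).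

The lifted Hankel tool of `…FormalLogLinearisationLifted{HyperbolicCross,SlotRank,CellRank,PencilCountBound}.lean`
(p595517 lineage) bounds pencil-visible points of an exponential sum `F(ν) = Σ_{k∈κ} c_k ∏ a_{ki}^{ν_i}` using exactly
two `F`-specific facts: the hyperbolic cross `∏ (v_i + 1) ≤ |κ|` and the slot rank `#D ≤ |κ|`.  Both only use that the
SHIFTS of `F` factor through `|κ|` coordinates.  This file restates them for an ARBITRARY function
`F : (Fin s → ℕ) → ℂ` of FINITE SHIFT RANK: `F(β + w) = Σ_{i ∈ ι} col β i · ch i w` for a finite index type `ι`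
(exponential sums: `ι = κ`; exponential-BINOMIAL sums `Σ_k c_k ∏_i C(ν_i, d_{ki}) a_{ki}^{ν_i − d_{ki}}`:
`ι = {(k, j) : j ≤ d_k}` by the Vandermonde addition formula, `|ι| = Σ_k ∏_i (d_{ki} + 1)` — sequel files):

* `ShiftRank.hyperbolicCross` — a strict `θ`-minimiser `v` of `{F ≠ 0}` has `∏ (v_i + 1) ≤ |ι|`;
* `ShiftRank.card_support_le_log` — hence `#supp v ≤ log₂ |ι|`;
* `ShiftRank.slotRank_card_le` — the slot-rank lemma `#D ≤ |ι|` for cell families (hypotheses of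
  `ExpSum.slotRank_card_le` verbatim, `F` abstract).

Honest framing: elementary linear algebra (copy-adaptation of the landed `ExpSum` proofs) for the THEORY lane of the
`relation_ladder` line; the crux `TwoProducts` (stmt-5906) stays OPEN, no rung of record moves, and nothing here is
progress on `VP ≠ VNP` (NOT proved).  No definitions, no named facts. [folklore]
-/

noncomputable section

-- Sub = Summit single-conjunct layout: the duplicated namespace component is mandated by the tree.
set_option linter.dupNamespace false

namespace Summit.ValiantsHypothesis.ValiantsHypothesis.Theorems.NewtonUnitEquations.TwoProducts.FormalLogLinearisation

open scoped BigOperators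

namespace ShiftRank

variable {s : ℕ}

/-- **Shift relations transfer to `F`.**  If `F(β + w) = Σ_i col β i · ch i w` and `Σ_β g_β · col β = 0`
coordinatewise, then `Σ_β g_β F(β + w) = 0` for every `w`. [folklore] -/
theorem sum_shift_eq_zero {ι : Type*} [Fintype ι] {F : (Fin s → ℕ) → ℂ} {col : (Fin s → ℕ) → ι → ℂ}
    {ch : ι → (Fin s → ℕ) → ℂ} (hF : ∀ β w : Fin s → ℕ, F (β + w) = ∑ i, col β i * ch i w)
    {D : Type*} [Fintype D] (pt : D → (Fin s → ℕ)) (g : D → ℂ)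
    (hrel : ∀ i, ∑ β, g β * col (pt β) i = 0) (w : Fin s → ℕ) :
    ∑ β, g β * F (pt β + w) = 0 := by
  calc ∑ β, g β * F (pt β + w)
      = ∑ β, ∑ i, g β * (col (pt β) i * ch i w) := by
        refine Finset.sum_congr rfl fun β _ => ?_
        rw [hF, Finset.mul_sum]
    _ = ∑ i, ch i w * ∑ β, g β * col (pt β) i := by
        rw [Finset.sum_comm]
        refine Finset.sum_congr rfl fun i _ => ?_
        rw [Finset.mul_sum]
        exact Finset.sum_congr rfl fun β _ => by ring
    _ = 0 := Finset.sum_eq_zero fun i _ => by rw [hrel i, mul_zero]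

/-- **HYPERBOLIC-CROSS LEMMA for functions of finite shift rank.**  Let `F(β + w) = Σ_{i∈ι} col β i · ch i w` and let
`θ` be any real grading.  If `F(v) ≠ 0` and `F(ν) = 0` for every `ν ≠ v` with `⟨θ,ν⟩ ≤ ⟨θ,v⟩` (i.e. `v` is the
STRICT `θ`-minimiser of `{F ≠ 0}`), then `∏_i (v_i + 1) ≤ |ι|`.  (The `∏(v_i+1)` columns `col β`, `β ≤ v`, in `ℂ^ι`
are dependent; shift the relation so that its `θ`-heaviest term sits at `v`.) [folklore] -/
theorem hyperbolicCross {ι : Type*} [Fintype ι] {F : (Fin s → ℕ) → ℂ} {col : (Fin s → ℕ) → ι → ℂ}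
    {ch : ι → (Fin s → ℕ) → ℂ} (hF : ∀ β w : Fin s → ℕ, F (β + w) = ∑ i, col β i * ch i w) (θ : Fin s → ℝ)
    (v : Fin s → ℕ) (hv : F v ≠ 0)
    (hmin : ∀ ν : Fin s → ℕ, ν ≠ v → ∑ i, θ i * (ν i : ℝ) ≤ ∑ i, θ i * (v i : ℝ) → F ν = 0) :
    ∏ i, (v i + 1) ≤ Fintype.card ι := by
  classical
  by_contra hlt
  push Not at hlt
  set D := Fintype.piFinset fun i => Finset.range (v i + 1) with hD
  -- too many columns: they are linearly dependent in `ι → ℂ`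
  have hdep : ¬ LinearIndependent ℂ (fun β : D => col β.1) := by
    intro hli
    have h1 := hli.fintype_card_le_finrank
    rw [Module.finrank_fintype_fun_eq_card, Fintype.card_coe, hD, ExpSum.card_boxBelow] at h1
    exact absurd h1 (not_le.mpr hlt)
  obtain ⟨g, hg0, ⟨β₀, hβ₀⟩⟩ := Fintype.not_linearIndependent_iff.mp hdep
  -- a `θ`-heaviest index in the support of `g`
  obtain ⟨βs, hβs, hmax⟩ := Finset.exists_max_image (Finset.univ.filter fun β : D => g β ≠ 0)
    (fun β : D => ∑ i, θ i * ((β.1 i : ℕ) : ℝ)) ⟨β₀, Finset.mem_filter.mpr ⟨Finset.mem_univ _, hβ₀⟩⟩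
  have hgβs : g βs ≠ 0 := (Finset.mem_filter.mp hβs).2
  have hβsle : ∀ i, βs.1 i ≤ v i := ExpSum.mem_boxBelow.mp βs.2
  -- the shift `w = v − βs` (componentwise, `βs ≤ v`)
  set w : Fin s → ℕ := fun i => v i - βs.1 i with hw
  have hβsw : βs.1 + w = v := funext fun i => by
    have := hβsle i; simp only [Pi.add_apply, hw]; omega
  -- the relation, coordinatewise
  have hrel : ∀ i, ∑ β : D, g β * col β.1 i = 0 := fun i => by
    have := congr_fun hg0 i
    simpa [Finset.sum_apply, Pi.smul_apply, smul_eq_mul] using this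
  -- hence the shifted relation `Σ_β g_β F(β + w) = 0`
  have hshift : ∑ β : D, g β * F (β.1 + w) = 0 := sum_shift_eq_zero hF (fun β : D => β.1) g hrel w
  -- all terms other than `β = βs` vanish: they sit at points `≠ v` of weight `≤ ⟨θ, v⟩`
  have hvan : ∀ β : D, β ≠ βs → g β * F (β.1 + w) = 0 := by
    intro β hne
    by_cases hgβ : g β = 0
    · rw [hgβ, zero_mul]
    have hle : ∑ i, θ i * ((β.1 i : ℕ) : ℝ) ≤ ∑ i, θ i * ((βs.1 i : ℕ) : ℝ) :=
      hmax β (Finset.mem_filter.mpr ⟨Finset.mem_univ _, hgβ⟩)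
    have hne' : β.1 + w ≠ v := by
      intro h
      apply hne
      apply Subtype.ext
      funext i
      have h1 : β.1 i + w i = v i := by simpa only [Pi.add_apply] using congr_fun h i
      have h2 : βs.1 i + w i = v i := by simpa only [Pi.add_apply] using congr_fun hβsw i
      omega
    have hwt : ∑ i, θ i * (((β.1 + w) i : ℕ) : ℝ) ≤ ∑ i, θ i * (v i : ℝ) := by
      rw [← hβsw]
      simp only [Pi.add_apply, Nat.cast_add]
      have e1 : ∑ i, θ i * ((β.1 i : ℝ) + (w i : ℝ)) = ∑ i, θ i * (β.1 i : ℝ) + ∑ i, θ i * (w i : ℝ) := by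
        rw [← Finset.sum_add_distrib]; exact Finset.sum_congr rfl fun i _ => by ring
      have e2 : ∑ i, θ i * ((βs.1 i : ℝ) + (w i : ℝ)) = ∑ i, θ i * (βs.1 i : ℝ) + ∑ i, θ i * (w i : ℝ) := by
        rw [← Finset.sum_add_distrib]; exact Finset.sum_congr rfl fun i _ => by ring
      linarith
    rw [hmin _ hne' hwt, mul_zero]
  -- so the `βs`-term, `g βs · F(v)`, vanishes too
  rw [← Finset.sum_erase_add _ _ (Finset.mem_univ βs),
    Finset.sum_eq_zero (fun β hβ => hvan β (Finset.ne_of_mem_erase hβ)), zero_add, hβsw] at hshift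
  exact hv ((mul_eq_zero.mp hshift).resolve_left hgβs)

/-- **Support bound from the hyperbolic cross.**  `2 ^ |supp v| ≤ ∏ (v_i + 1) ≤ n` gives `|supp v| ≤ log₂ n`.
[folklore] -/
theorem card_support_le_log_of_prod_le (v : Fin s → ℕ) {n : ℕ} (hcross : ∏ i, (v i + 1) ≤ n) :
    (Finset.univ.filter fun i => v i ≠ 0).card ≤ Nat.log 2 n := by
  classical
  have hpow : 2 ^ (Finset.univ.filter fun i => v i ≠ 0).card ≤ ∏ i, (v i + 1) := by
    calc 2 ^ (Finset.univ.filter fun i => v i ≠ 0).card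
        = ∏ i ∈ Finset.univ.filter (fun i => v i ≠ 0), 2 := by simp
      _ ≤ ∏ i ∈ Finset.univ.filter (fun i => v i ≠ 0), (v i + 1) := by
          refine Finset.prod_le_prod' fun i hi => ?_
          have := (Finset.mem_filter.mp hi).2
          omega
      _ ≤ ∏ i, (v i + 1) :=
          Finset.prod_le_prod_of_subset_of_one_le' (Finset.filter_subset _ _) fun i _ _ => Nat.succ_pos _
  exact Nat.le_log_of_pow_le (by norm_num) (hpow.trans hcross)

/-- **Support bound, shift-rank form.**  A strict `θ`-minimiser of `{F ≠ 0}` uses at most `log₂ |ι|` coordinates.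
[folklore] -/
theorem card_support_le_log {ι : Type*} [Fintype ι] {F : (Fin s → ℕ) → ℂ} {col : (Fin s → ℕ) → ι → ℂ}
    {ch : ι → (Fin s → ℕ) → ℂ} (hF : ∀ β w : Fin s → ℕ, F (β + w) = ∑ i, col β i * ch i w) (θ : Fin s → ℝ)
    (v : Fin s → ℕ) (hv : F v ≠ 0)
    (hmin : ∀ ν : Fin s → ℕ, ν ≠ v → ∑ i, θ i * (ν i : ℝ) ≤ ∑ i, θ i * (v i : ℝ) → F ν = 0) :
    (Finset.univ.filter fun i => v i ≠ 0).card ≤ Nat.log 2 (Fintype.card ι) :=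
  card_support_le_log_of_prod_le v (hyperbolicCross hF θ v hv hmin)

/-- **SLOT-RANK LEMMA for functions of finite shift rank.**  Let `F(β + w) = Σ_{i∈ι} col β i · ch i w`, `e ≥ 1`, and
let `D` be a set of coordinates such that every `d ∈ D` has a REPRESENTATIVE `rep d` with `(rep d)_d = e`,
`F(rep d) ≠ 0`, strictly `(u + τ_d v)`-minimal in `{F ≠ 0}`, all parameters `τ_d` inducing the same weight order on
the coordinates as a reference parameter `t₀`.  Then `#D ≤ |ι|`: sorted along that order, the matrix
`(F(ρ_y + e·e_{d_x}))_{x,y}` (`ρ_y = rep d_y` with coordinate `d_y` zeroed) vanishes above the diagonal, is nonzero on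
it, and factors through `ι` (`F(e·e_{d_x} + ρ_y) = Σ_i col(e·e_{d_x}) i · ch i ρ_y`). [folklore] -/
theorem slotRank_card_le {ι : Type*} [Fintype ι] {F : (Fin s → ℕ) → ℂ} {col : (Fin s → ℕ) → ι → ℂ}
    {ch : ι → (Fin s → ℕ) → ℂ} (hF : ∀ β w : Fin s → ℕ, F (β + w) = ∑ i, col β i * ch i w) (u v : Fin s → ℝ)
    (e : ℕ) (he : 1 ≤ e) (t₀ : ℝ) (D : Finset (Fin s)) (rep : Fin s → (Fin s → ℕ)) (τ : Fin s → ℝ)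
    (hrep : ∀ d ∈ D, rep d d = e ∧ F (rep d) ≠ 0 ∧
      (∀ ν : Fin s → ℕ, ν ≠ rep d → F ν ≠ 0 →
        ∑ i, (u i + τ d * v i) * (rep d i : ℝ) < ∑ i, (u i + τ d * v i) * (ν i : ℝ)) ∧
      (∀ j j' : Fin s, (u j + τ d * v j ≤ u j' + τ d * v j') ↔ (u j + t₀ * v j ≤ u j' + t₀ * v j'))) :
    D.card ≤ Fintype.card ι := by
  classical
  -- sort `D` along the common order (ties broken by the index)
  let key : Fin s → Lex (ℝ × ℕ) := fun d => toLex (u d + t₀ * v d, (d : ℕ))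
  have hkey : Set.InjOn key ↑D := by
    intro d _ d' _ h
    have h2 : ((ofLex (key d)).2) = (ofLex (key d')).2 := by rw [h]
    exact Fin.ext (by simpa [key] using h2)
  set q := D.card with hq
  have hcard : (D.image key).card = q := Finset.card_image_of_injOn hkey
  let em : Fin q ↪o Lex (ℝ × ℕ) := (D.image key).orderEmbOfFin hcard
  have hem : ∀ x : Fin q, ∃ d ∈ D, key d = em x := fun x => by
    simpa only [Finset.mem_image] using (D.image key).orderEmbOfFin_mem hcard x
  choose f hfD hfkey using hem
  have hfinj : Function.Injective f := by
    intro x y h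
    have : em x = em y := by rw [← hfkey x, ← hfkey y, h]
    exact em.injective this
  have hfle : ∀ x y : Fin q, x < y → u (f x) + t₀ * v (f x) ≤ u (f y) + t₀ * v (f y) := by
    intro x y hxy
    have hlt : key (f x) < key (f y) := by rw [hfkey, hfkey]; exact em.strictMono hxy
    exact (Prod.Lex.toLex_lt_toLex'.1 hlt).1
  -- the matrix
  let ρ : Fin q → (Fin s → ℕ) := fun y => Function.update (rep (f y)) (f y) 0
  let P : Matrix (Fin q) ι ℂ := fun x i => col (Pi.single (f x) e : Fin s → ℕ) i
  let Q : Matrix ι (Fin q) ℂ := fun i y => ch i (ρ y)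
  have hPQ : ∀ x y, (P * Q) x y = F (ρ y + (Pi.single (f x) e : Fin s → ℕ)) := fun x y => by
    simp only [Matrix.mul_apply, P, Q]
    rw [add_comm, hF]
  have hρself : ∀ y, ρ y + (Pi.single (f y) e : Fin s → ℕ) = rep (f y) := fun y => by
    have := ExpSum.update_add_single (rep (f y)) (f y)
    rw [(hrep (f y) (hfD y)).1] at this
    exact this
  refine card_le_of_triangular_factor' P Q (fun y => ?_) (fun x y hxy => ?_)
  · rw [hPQ, hρself]; exact (hrep (f y) (hfD y)).2.1
  · rw [hPQ]
    obtain ⟨hdiag, -, hvis, hord⟩ := hrep (f y) (hfD y)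
    by_contra hFν
    have hνne : ρ y + (Pi.single (f x) e : Fin s → ℕ) ≠ rep (f y) := by
      intro h
      have h1 := congrFun h (f y)
      have hxy' : f x ≠ f y := fun h' => (hfinj h' ▸ hxy).false
      simp only [Pi.add_apply, ρ, Function.update_self, Pi.single_apply, hxy'.symm, if_false, add_zero] at h1
      rw [hdiag] at h1
      omega
    have hlt := hvis _ hνne hFν
    -- but the new point is no heavier than `rep (f y)` at `τ (f y)`
    have hle' : u (f x) + τ (f y) * v (f x) ≤ u (f y) + τ (f y) * v (f y) := (hord _ _).2 (hfle x y hxy)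
    have hw1 := ExpSum.wsum_add_single u v (τ (f y)) (ρ y) (f x) e
    have hw2 := ExpSum.wsum_add_single u v (τ (f y)) (ρ y) (f y) e
    rw [hρself] at hw2
    have hepos : (0 : ℝ) ≤ (e : ℝ) := by positivity
    have := mul_le_mul_of_nonneg_left hle' hepos
    linarith

end ShiftRank

end Summit.ValiantsHypothesis.ValiantsHypothesis.Theorems.NewtonUnitEquations.TwoProducts.FormalLogLinearisation

end
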